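import Literature.InformationTheory.Entanglement.TwoRebitSeparabilityProbabilityEigen
import Literature.InformationTheory.Entanglement.TwoRebitSeparabilityProbabilityBall
import HarnessLib

/-!
# Two-rebit separability probability on a fibre: the volume of the fibre body, `λ₇(D_ℝ(𝟙)) = π³/420`

Fifth step of the proof of Lovas–Andai 2017, Theorems 1–2 on the fibre over `D = 𝟙`: the
elementary "denominator" integral of the proof of Theorem 2 in our coordinates,

  `∫⁻ m, ∫⁻_{r ∈ (0, ∞), r < min(m, 1 − m)} r x y (1 − x)(1 − y) = 1/1120`
  (`x = m + r`, `y = m − r`; Lovas–Andai: "the denominator is equal to `16/35`" for the weight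
  `(1 − x²)(1 − y²)(x − y)` on `−1 < y < x < 1`, which is `128 ×` ours after `x ↦ 2x − 1`),

whence, with `λ₄(𝔹) = 2π²/3` (`volume_rebitOpBall`) and `volume_rebitFibreBody_one_eigen`,

* `volume_rebitFibreBody_one` : `λ₇(D_ℝ(𝟙)) = 4π · (2π²/3) · (1/1120) = π³/420` — the
  Hilbert–Schmidt volume of the two-rebit states with maximally mixed reduced state, in the chart
  `rebitFibreDensity 𝟙` (Lovas–Andai §5, `Vol(D_{4,ℝ}(D))`, up to the chart normalisation), in
  particular it is positive and finite;
* `LovasAndai2017_rebit_fibre_2964_iff_numerator` : the fibre fact is equivalent to the single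
  remaining identity `64 · ∫∫ r w χ(ε) = 29 · (2π²/3) / 1120` for the "numerator"
  (`χ(ε) = λ₄(rebitDefectBall ε)`; what is left is Lemma 6 and the integral of Theorem 2).

## References

* [LovasAndai2017] A. Lovas, A. Andai, Invariance of separability probability over reduced states
  in 4 × 4 bipartite systems, J. Phys. A 50 (2017) 295303, Theorem 2 (proof: the denominator
  `16/35`), §5 (volumes), Table 2.
-/

noncomputable section

open MeasureTheory Set Real
open scoped ENNReal Matrix

namespace Literature.InformationTheory.Entanglement

/-! ### The inner integral in closed form -/

/-- The antiderivative in `r` of the weight: `∫₀^c r (m² − r²)((1−m)² − r²) dr`. [folklore] -/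
def rebitEigenInner (m c : ℝ) : ℝ :=
  m ^ 2 * (1 - m) ^ 2 * c ^ 2 / 2 - (m ^ 2 + (1 - m) ^ 2) * c ^ 4 / 4 + c ^ 6 / 6

/-- `∫₀^c r x y (1−x)(1−y) dr = rebitEigenInner m c`. [folklore] -/
theorem integral_rebitEigenWeight (m c : ℝ) :
    ∫ r in (0 : ℝ)..c, rebitEigenWeight m r = rebitEigenInner m c := by
  have h : ∀ r ∈ uIcc (0 : ℝ) c, HasDerivAt (fun r : ℝ => rebitEigenInner m r)
      (rebitEigenWeight m r) r := by
    intro r _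
    unfold rebitEigenInner
    have hid := hasDerivAt_id r
    have h2 := hid.mul hid
    have h4 := h2.mul h2
    have h6 := h4.mul h2
    refine ((((h2.const_mul (m ^ 2 * (1 - m) ^ 2)).div_const 2).sub
      ((h4.const_mul (m ^ 2 + (1 - m) ^ 2)).div_const 4)).add (h6.div_const 6)).congr_of_eventuallyEq
        ?_ |>.congr_deriv ?_
    · refine Filter.Eventually.of_forall fun x => ?_
      simp only [Pi.add_apply, Pi.sub_apply, Pi.mul_apply, id]
      ring
    · unfold rebitEigenWeight
      simp only [Pi.mul_apply, id]
      ring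
  rw [intervalIntegral.integral_eq_sub_of_hasDerivAt h
    ((continuous_rebitEigenWeight m).intervalIntegrable 0 c)]
  simp [rebitEigenInner]

/-- The weight is non-negative on the admissible region. [folklore] -/
theorem rebitEigenWeight_nonneg {m r : ℝ} (hr : 0 ≤ r) (h1 : r ≤ m) (h2 : r ≤ 1 - m) :
    0 ≤ rebitEigenWeight m r := by
  unfold rebitEigenWeight
  apply mul_nonneg hr
  apply mul_nonneg
  · apply mul_nonneg
    · nlinarith
    · linarith
  · linarith

/-- **The inner integral**: `∫⁻_{r ∈ (0,∞), r < min(m, 1−m)} r w = ofReal (rebitEigenInner m (min m (1 − m)))`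
for `0 ≤ min(m, 1 − m)`. [folklore] -/
theorem lintegral_Ioi_indicator_rebitEigenWeight {m : ℝ} (hm : 0 ≤ min m (1 - m)) :
    ∫⁻ r in Ioi (0 : ℝ), (rebitEigenSet m).indicator
        (fun r => ENNReal.ofReal (rebitEigenWeight m r)) r =
      ENNReal.ofReal (rebitEigenInner m (min m (1 - m))) := by
  have hS : rebitEigenSet m = Iio (min m (1 - m)) := by
    ext r
    simp [rebitEigenSet]
  rw [lintegral_indicator (measurableSet_rebitEigenSet m), Measure.restrict_restrict
    (measurableSet_rebitEigenSet m), hS, Iio_inter_Ioi, ← ofReal_integral_eq_lintegral_ofReal,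
    ← integral_Ioc_eq_integral_Ioo, ← intervalIntegral.integral_of_le hm, integral_rebitEigenWeight]
  · exact ((continuous_rebitEigenWeight m).integrableOn_Icc).mono_set Ioo_subset_Icc_self
  · refine (ae_restrict_iff' measurableSet_Ioo).2 (Filter.Eventually.of_forall fun r hr => ?_)
    have h1 : r < m := (lt_min_iff.1 hr.2).1
    have h2 : r < 1 - m := (lt_min_iff.1 hr.2).2
    exact rebitEigenWeight_nonneg hr.1.le h1.le h2.le

/-- Outside `0 < m < 1` the inner integral vanishes (the region is empty). [folklore] -/
theorem lintegral_Ioi_indicator_rebitEigenWeight_eq_zero {m : ℝ} (hm : m ≤ 0 ∨ 1 ≤ m) :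
    ∫⁻ r in Ioi (0 : ℝ), (rebitEigenSet m).indicator
        (fun r => ENNReal.ofReal (rebitEigenWeight m r)) r = 0 := by
  refine (lintegral_eq_zero_iff' ?_).2 ?_
  · exact ((ENNReal.measurable_ofReal.comp (continuous_rebitEigenWeight m).measurable).indicator
      (measurableSet_rebitEigenSet m)).aemeasurable
  · refine (ae_restrict_iff' measurableSet_Ioi).2 (Filter.Eventually.of_forall fun r hr => ?_)
    have hnot : r ∉ rebitEigenSet m := by
      rintro ⟨h1, h2⟩
      rcases hm with hm | hm
      · exact absurd (lt_trans hr h1) (not_lt.2 hm)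
      · have : (0 : ℝ) < 1 - m := lt_trans hr h2
        linarith
    simp [indicator_of_notMem hnot]

/-! ### The outer integral: `1/1120` -/

/-- The inner integral on the half `0 < m ≤ 1/2` (`min(m, 1−m) = m`):
`g(m) = m⁴(1−m)²/4 − m⁶/12`. [folklore] -/
def rebitEigenOuter (m : ℝ) : ℝ :=
  m ^ 4 * (1 - m) ^ 2 / 4 - m ^ 6 / 12

/-- `rebitEigenInner m m = g(m)`. [folklore] -/
theorem rebitEigenInner_self (m : ℝ) : rebitEigenInner m m = rebitEigenOuter m := by
  unfold rebitEigenInner rebitEigenOuter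
  ring

/-- `rebitEigenInner m (1 − m) = g(1 − m)`. [folklore] -/
theorem rebitEigenInner_one_sub (m : ℝ) : rebitEigenInner m (1 - m) = rebitEigenOuter (1 - m) := by
  unfold rebitEigenInner rebitEigenOuter
  ring

/-- `∫₀^{1/2} g = 1/2240`. [folklore] -/
theorem integral_rebitEigenOuter : ∫ m in (0 : ℝ)..(1 / 2), rebitEigenOuter m = 1 / 2240 := by
  have h : ∀ m ∈ uIcc (0 : ℝ) (1 / 2), HasDerivAt
      (fun m : ℝ => m ^ 5 / 20 - m ^ 6 / 12 + m ^ 7 / 42) (rebitEigenOuter m) m := by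
    intro m _
    have hid := hasDerivAt_id m
    have h2 := hid.mul hid
    have h4 := h2.mul h2
    have h5 := h4.mul hid
    have h6 := h4.mul h2
    have h7 := h6.mul hid
    refine ((((h5.div_const 20).sub (h6.div_const 12)).add (h7.div_const 42)).congr_of_eventuallyEq
      ?_).congr_deriv ?_
    · refine Filter.Eventually.of_forall fun x => ?_
      simp only [Pi.add_apply, Pi.sub_apply, Pi.mul_apply, id]
      ring
    · unfold rebitEigenOuter
      simp only [Pi.mul_apply, id]
      ring
  rw [intervalIntegral.integral_eq_sub_of_hasDerivAt h ((by unfold rebitEigenOuter; fun_prop :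
    Continuous rebitEigenOuter).intervalIntegrable _ _)]
  norm_num

/-- `rebitEigenOuter` is continuous. [folklore] -/
theorem continuous_rebitEigenOuter : Continuous rebitEigenOuter := by
  unfold rebitEigenOuter
  fun_prop

/-- The inner integral as a function of `m ∈ [0, 1]`: `E(m) = rebitEigenInner m (min m (1 − m))`.
[folklore] -/
def rebitEigenE (m : ℝ) : ℝ :=
  rebitEigenInner m (min m (1 - m))

/-- `E` is continuous. [folklore] -/
theorem continuous_rebitEigenE : Continuous rebitEigenE := by
  unfold rebitEigenE rebitEigenInner
  have hmin : Continuous fun m : ℝ => min m (1 - m) := continuous_id.min (by fun_prop)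
  fun_prop

/-- `E ≥ 0` on `[0, 1]` (it is the integral of the non-negative weight). [folklore] -/
theorem rebitEigenE_nonneg {m : ℝ} (hm : m ∈ Icc (0 : ℝ) 1) : 0 ≤ rebitEigenE m := by
  have h0 : 0 ≤ min m (1 - m) := le_min hm.1 (by linarith [hm.2])
  rw [rebitEigenE, ← integral_rebitEigenWeight]
  refine intervalIntegral.integral_nonneg h0 fun r hr => ?_
  exact rebitEigenWeight_nonneg hr.1 ((le_min_iff.1 hr.2).1) ((le_min_iff.1 hr.2).2)

/-- `E = g` on `[0, 1/2]`. [folklore] -/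
theorem rebitEigenE_eq_left {m : ℝ} (hm : m ∈ uIcc (0 : ℝ) (1 / 2)) :
    rebitEigenE m = rebitEigenOuter m := by
  rw [uIcc_of_le (by norm_num : (0 : ℝ) ≤ 1 / 2)] at hm
  rw [rebitEigenE, min_eq_left (by linarith [hm.2]), rebitEigenInner_self]

/-- `E = g(1 − ·)` on `[1/2, 1]`. [folklore] -/
theorem rebitEigenE_eq_right {m : ℝ} (hm : m ∈ uIcc (1 / 2 : ℝ) 1) :
    rebitEigenE m = rebitEigenOuter (1 - m) := by
  rw [uIcc_of_le (by norm_num : (1 / 2 : ℝ) ≤ 1)] at hm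
  rw [rebitEigenE, min_eq_right (by linarith [hm.1]), rebitEigenInner_one_sub]

/-- `∫₀¹ E = 1/1120`. [folklore] -/
theorem integral_rebitEigenE : ∫ m in (0 : ℝ)..1, rebitEigenE m = 1 / 1120 := by
  have hint : ∀ a b : ℝ, IntervalIntegrable rebitEigenE volume a b :=
    fun a b => continuous_rebitEigenE.intervalIntegrable a b
  have e1 : (1 : ℝ) - 1 = 0 := by norm_num
  have e2 : (1 : ℝ) - 1 / 2 = 1 / 2 := by norm_num
  rw [← intervalIntegral.integral_add_adjacent_intervals (hint 0 (1 / 2)) (hint (1 / 2) 1),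
    intervalIntegral.integral_congr (fun m hm => rebitEigenE_eq_left hm),
    intervalIntegral.integral_congr (fun m hm => rebitEigenE_eq_right hm),
    intervalIntegral.integral_comp_sub_left (fun m => rebitEigenOuter m) 1, e1, e2,
    integral_rebitEigenOuter]
  norm_num

/-- **The denominator integral** (Lovas–Andai: `16/35`; here `1/1120` for the weight
`r x y (1−x)(1−y)` on `0 < y < x < 1`):
`∫⁻ m, ∫⁻_{r ∈ (0,∞), r < min(m,1−m)} r w = 1/1120`.
[cite: LovasAndai2017, Theorem 2 (proof: "the denominator is equal to 16/35")] -/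
theorem lintegral_rebitEigenWeight :
    ∫⁻ m : ℝ, ∫⁻ r in Ioi (0 : ℝ),
        (rebitEigenSet m).indicator (fun r => ENNReal.ofReal (rebitEigenWeight m r)) r =
      ENNReal.ofReal (1 / 1120) := by
  set G : ℝ → ℝ≥0∞ := fun m => ∫⁻ r in Ioi (0 : ℝ),
    (rebitEigenSet m).indicator (fun r => ENNReal.ofReal (rebitEigenWeight m r)) r with hG
  have hGE : ∀ m ∈ Ioo (0 : ℝ) 1, G m = ENNReal.ofReal (rebitEigenE m) := by
    intro m hm
    have h0 : 0 ≤ min m (1 - m) := le_min hm.1.le (by linarith [hm.2])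
    show (∫⁻ r in Ioi (0 : ℝ), (rebitEigenSet m).indicator
      (fun r => ENNReal.ofReal (rebitEigenWeight m r)) r) = _
    rw [lintegral_Ioi_indicator_rebitEigenWeight h0]
    rfl
  have hG0 : ∀ m, m ∉ Ioo (0 : ℝ) 1 → G m = 0 := by
    intro m hm
    simp only [mem_Ioo, not_and_or, not_lt] at hm
    exact lintegral_Ioi_indicator_rebitEigenWeight_eq_zero hm
  have hind : (fun m => G m) = (Ioo (0 : ℝ) 1).indicator G := by
    funext m
    by_cases hm : m ∈ Ioo (0 : ℝ) 1
    · rw [indicator_of_mem hm]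
    · rw [indicator_of_notMem hm, hG0 m hm]
  have step1 : ∫⁻ m, G m = ∫⁻ m in Ioo (0 : ℝ) 1, G m := by
    rw [← lintegral_indicator measurableSet_Ioo, ← hind]
  rw [step1, setLIntegral_congr_fun measurableSet_Ioo hGE, ← ofReal_integral_eq_lintegral_ofReal,
    ← integral_Ioc_eq_integral_Ioo, ← intervalIntegral.integral_of_le zero_le_one,
    integral_rebitEigenE]
  · exact continuous_rebitEigenE.integrableOn_Icc.mono_set Ioo_subset_Icc_self
  · exact (ae_restrict_iff' measurableSet_Ioo).2
      (Filter.Eventually.of_forall fun m hm => rebitEigenE_nonneg (Ioo_subset_Icc_self hm))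

/-! ### The volume of the fibre body and the last reduction of the fact -/

/-- **The Hilbert–Schmidt volume of the fibre over the maximally mixed state**:
`λ₇(D_ℝ(𝟙)) = λ₇{(X, Z) | [[X, Z], [Zᵀ, 𝟙 − X]] ≽ 0} = π³/420`
(`= 4π · χ₁(1) · (1/1120)`, `χ₁(1) = 2π²/3`; Lovas–Andai §5: `Vol(D_{4,ℝ}(D)) = χ₁(1) det(D)^{7/2}
2^{−6} ∫_E det(I−Y²) dY` in their normalisation). [cite: LovasAndai2017, §5 and Table 2 (χ₁(1) = 2π²/3, ∫_E det(I−Y²) = 2⁵√2π/35)] -/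
theorem volume_rebitFibreBody_one :
    volume (rebitFibreBody (1 : Matrix (Fin 2) (Fin 2) ℝ)) = ENNReal.ofReal (π ^ 3 / 420) := by
  rw [volume_rebitFibreBody_one_eigen, lintegral_rebitEigenWeight, volume_rebitOpBall,
    ← ENNReal.ofReal_mul (by positivity), ← ENNReal.ofReal_mul (by positivity)]
  congr 1
  ring

/-- The fibre body over `𝟙` has positive volume (so the separability probability of the fibre is
a genuine ratio). [folklore] -/
theorem volume_rebitFibreBody_one_pos :
    0 < volume (rebitFibreBody (1 : Matrix (Fin 2) (Fin 2) ℝ)) := by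
  rw [volume_rebitFibreBody_one, ENNReal.ofReal_pos]
  positivity

/-- **The fibre fact reduced to the numerator** (Theorem 2 proper): `LovasAndai2017_rebit_fibre_2964`
holds iff `64 · ∫⁻ m, ∫⁻_{r ∈ (0,∞), r < min(m,1−m)} r w · χ(ε(m, r)) = 29 · (2π²/3) · (1/1120)`,
`χ(ε) = λ₄(rebitDefectBall ε)` (Lovas–Andai: numerator `= 16/35 − 1/4`, i.e.
`𝒫_sep(ℝ) = (16/35 − 1/4)/(16/35) = 29/64`). [cite: LovasAndai2017, Theorem 2 (proof)] -/
theorem LovasAndai2017_rebit_fibre_2964_iff_numerator :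
    LovasAndai2017_rebit_fibre_2964 ↔
      64 * ∫⁻ m : ℝ, ∫⁻ r in Ioi (0 : ℝ),
          (rebitEigenSet m).indicator (fun r => ENNReal.ofReal (rebitEigenWeight m r) *
            volume (rebitDefectBall (rebitEigenEps m r))) r =
        29 * ENNReal.ofReal (2 * π ^ 2 / 3 * (1 / 1120)) := by
  rw [LovasAndai2017_rebit_fibre_2964_iff_eigen, lintegral_rebitEigenWeight, volume_rebitOpBall,
    ← ENNReal.ofReal_mul (by positivity)]

end Literature.InformationTheory.Entanglement

end
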